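import Mathlib
import Summits.Langlands.Langlands.Theses.PhantomRMYoshida

/-!
# Sketch — first lemmas of the three crux idea cards for `StableYoshidaCongruence`
(stmt-Langlands-13640), planner-cruxidea-…-1, round 1.  Statements only (Props); nothing proved.
-/

namespace Summit.Langlands.Langlands.Cruxes.StableYoshidaCongruence.IdeaSketch

open Literature.NumberTheory.GaloisRepresentations IsDedekindDomain

/-! ## Card `paramodular-purity-torsion-locus` — first lemma (commutative algebra).
`H⁰` of a two-term complex of finite free modules over a domain is torsion-free, hence, if it is
non-zero, it is supported at EVERY prime — in particular at the weight-(2,2) prime of `Λ₁ = ℤ_p⟦T⟧`.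
This is the step "one holomorphic stable class at a generic weight (k,2) ⇒ one at weight (2,2)". -/
def KerFullSupport : Prop :=
  ∀ (Λ : Type) [CommRing Λ] [IsDomain Λ] [IsNoetherianRing Λ]
    (M N : Type) [AddCommGroup M] [Module Λ M] [Module.Finite Λ M] [Module.Free Λ M]
    [AddCommGroup N] [Module Λ N] [Module.Finite Λ N] [Module.Free Λ N]
    (f : M →ₗ[Λ] N), LinearMap.ker f ≠ ⊥ →
      Module.support Λ (LinearMap.ker f) = Set.univ

/-! ## Card `wall-companion-trichotomy` — first lemma (commutative algebra).
For an INJECTIVE map of finite free modules over a Noetherian local ring (the case `H⁰ = 0` of the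
Klingen higher-Hida complex localised at the Yoshida ideal), the cokernel `H¹` is free iff the map
stays injective on the residue field, i.e. iff `Tor₁(H¹, κ) = 0` — "no mod-p holomorphic companion
⇔ H¹ free". -/
def CokerFreeIffResiduallyInjective : Prop :=
  ∀ (Λ : Type) [CommRing Λ] [IsLocalRing Λ] [IsNoetherianRing Λ]
    (M N : Type) [AddCommGroup M] [Module Λ M] [Module.Finite Λ M] [Module.Free Λ M]
    [AddCommGroup N] [Module Λ N] [Module.Finite Λ N] [Module.Free Λ N]
    (f : M →ₗ[Λ] N), Function.Injective f →
      (Module.Free Λ (N ⧸ LinearMap.range f) ↔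
        Function.Injective (LinearMap.lTensor (IsLocalRing.ResidueField Λ) f))

/-! ## Card `beilinson-flach-selection` — first lemma (Galois side, crux vocabulary).
Supply of CROSS-RATIO level-raising places for an eligible pair `(σ, σ')`: places `v` where the
Frobenius polynomials `P₁` of `σ` and `P₂` of `σ'` have roots `a`, `b` with `a = q_v · b`
(the residual vanishing of the Rankin–Selberg Euler factor at `v`, equivalently non-vanishing of the
local relaxed cross Selmer condition).  Chebotarev turns ONE such Frobenius into infinitely many. -/
def CrossRatioAt {p : ℕ} [Fact p.Prime] {k : Type} [Field k] [CharP k p] [TopologicalSpace k]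
    [DiscreteTopology k] (σ σ' : FramedGaloisRep ℚ k 2)
    (v : HeightOneSpectrum (NumberField.RingOfIntegers ℚ)) : Prop :=
  σ.IsUnramifiedAt v ∧ σ'.IsUnramifiedAt v ∧
    ∃ (P₁ P₂ : Polynomial k), σ.HasFrobCharpolyAt v P₁ ∧ σ'.HasFrobCharpolyAt v P₂ ∧
      ∃ a b : k, P₁.IsRoot a ∧ P₂.IsRoot b ∧ a = (v.residueCard : k) * b

def CrossRatioSupply : Prop :=
  ∀ (p : ℕ) [Fact p.Prime], p ≠ 2 → ∀ (k : Type) [Field k] [CharP k p] [IsAlgClosed k]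
    [TopologicalSpace k] [DiscreteTopology k] (σ σ' : FramedGaloisRep ℚ k 2),
    σ.toGaloisRep.IsIrreducible → σ'.toGaloisRep.IsIrreducible →
    (¬ ∃ g : GL (Fin 2) k, ∀ x, g * σ x * g⁻¹ = σ' x) →
    (∃ v, CrossRatioAt σ σ' v) →
      Set.Infinite {v : HeightOneSpectrum (NumberField.RingOfIntegers ℚ) | CrossRatioAt σ σ' v}

end Summit.Langlands.Langlands.Cruxes.StableYoshidaCongruence.IdeaSketch
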